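import Summits.HodgeConjecture.HodgeConjecture.Theorems.HeckePrymWeilAimedDescendingProductFrame
import Summits.HodgeConjecture.HodgeConjecture.Theorems.HeckePrymWeilHyperbolicEightfoldsSqrtMinus7EndAdditiveH1

/-!
# `AimedDescending` (stmt-HodgeConjecture-14643) · IX · the rational degree-one model of a product

Route `HeckePrymWeil`, support item `AimedDescending`. Files V–VIII set up RATIONAL DEGREE-ONE
MODELS `(u, M, ω, G, d)` of triples `(A, φ, h_A)` (file VII: they exist; file VIII: Weil type and
alternation; file VI: the hyperbolic frame of a product from models of the factors). The partner
surface of the product trick is itself a product, `B = E₀ × E₀` with `ψ = ι × (-ι)` and a weighted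
product class `m₁·pr₁^*η + m₂·pr₂^*η`, so the final assembly needs the MODEL OF A PRODUCT from
models of the factors — which is what this file provides, for arbitrary complex abelian varieties
`A`, `B` of dimensions `jA + 1`, `jB + 1` with endomorphisms `φ`, `ψ` and classes `h_A`, `h_B`:
the pulled-back frame `U = (pr_A^* uᵢ) ⊔ (pr_B^* w_k)` on `A × B`

* spans `H¹((A × B)(ℂ); ℂ)` when `u`, `w` span (`span_sumElim_map_fst_map_snd_eq_top`; Künneth in
  degree one, the tree's `exists_eq_map_fst_add_map_snd_deg_one`) and is `ℂ`-independent when they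
  are (file VI);
* has `(φ × ψ)^*`-matrix `M_A ⊕ M_B` (`map_prodLift_sumElim`);
* has, for `h = pr_A^* h_A + pr_B^* h_B` and `m = jA + jB + 1 = dim A + dim B - 1`, the block Gram
  matrix `C(m, jA)·d_B·G_A ⊕ C(m, jA+1)·d_A·G_B` with respect to `ω = pr_A^* ω_A ⌣ pr_B^* ω_B`
  (`polarizationPairingOne_sumElim`; file V), and
* top power `h^{dim A + dim B} = L^m_h h = C(m+1, jA+1)·d_A·d_B · ω` (`lefschetzPow_add_map_self`:
  `h = pr_A^*h_A ⌣ pr_B^*1 + pr_A^*1 ⌣ pr_B^*h_B`, the closed form of file V for each summand, one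
  surviving term each, Pascal).

Sources: B. van Geemen, LNM 1594 (1994), Lemma 5.2 (2)–(3); Ch. Birkenhake, H. Lange, *Complex
Abelian Varieties*, §5.3; A. Hatcher, *Algebraic Topology*, Thm. 3.16, Prop. 3.10, Thm. 3.11.
-/

noncomputable section

-- every declaration of this problem lives in `Summit.HodgeConjecture.HodgeConjecture.…`
set_option linter.dupNamespace false

open CategoryTheory MonoidalCategory
open Literature.AlgebraicGeometry Literature.AlgebraicGeometry.HodgeTheory
open Literature.AlgebraicTopology.SingularHomology
open Literature.Geometry.Kaehler
open Literature.AlgebraicGeometry.Motives (AbelianVariety)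

namespace Summit.HodgeConjecture.HodgeConjecture.Theorems

variable {A B : Motives.AbelianVariety ℂ}

/-! ### Spanning: Künneth in degree one -/

/-- **If `u` spans `H¹(A(ℂ))` and `w` spans `H¹(B(ℂ))`, the pulled-back frame spans
`H¹((A × B)(ℂ))`** (Künneth in degree one: every class is `pr_A^* a + pr_B^* b`, the tree's
`exists_eq_map_fst_add_map_snd_deg_one`). [cite: HatcherAT2002, §3.2 Thm. 3.16] -/
theorem span_sumElim_map_fst_map_snd_eq_top {ιA ιB : Type*} {u : ιA → complexBetti A.X 1}
    {w : ιB → complexBetti B.X 1} (hu : Submodule.span ℂ (Set.range u) = ⊤)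
    (hw : Submodule.span ℂ (Set.range w) = ⊤) :
    Submodule.span ℂ (Set.range (Sum.elim (fun i => complexBetti.map (AbelianVariety.fst A B).hom.hom.hom 1 (u i))
      (fun k => complexBetti.map (AbelianVariety.snd A B).hom.hom.hom 1 (w k)))) = ⊤ := by
  have hX : Motives.IsSmoothProjective A.dim A.X := Motives.AbelianVariety.isSmoothProjective_holds
  have hY : Motives.IsSmoothProjective B.dim B.X := Motives.AbelianVariety.isSmoothProjective_holds
  rw [eq_top_iff]
  rintro z -
  obtain ⟨a, b, rfl⟩ :=
    HyperbolicEightfoldsSqrtMinus7.DicyclicQuaternionSwitch.exists_eq_map_fst_add_map_snd_deg_one hX hY z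
  rw [Set.Sum.elim_range, Submodule.span_union]
  refine Submodule.add_mem_sup ?_ ?_
  · have ha : a ∈ Submodule.span ℂ (Set.range u) := by rw [hu]; trivial
    have h := Submodule.mem_map_of_mem (f := (complexBetti.map (AbelianVariety.fst A B).hom.hom.hom 1).hom) ha
    rw [Submodule.map_span, ← Set.range_comp] at h
    exact h
  · have hb : b ∈ Submodule.span ℂ (Set.range w) := by rw [hw]; trivial
    have h := Submodule.mem_map_of_mem (f := (complexBetti.map (AbelianVariety.snd A B).hom.hom.hom 1).hom) hb
    rw [Submodule.map_span, ← Set.range_comp] at h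
    exact h

/-! ### The matrix of `(φ × ψ)^*` -/

variable (φ : A ⟶ A) (ψ : B ⟶ B)

/-- **`(φ × ψ)^*` has matrix `M_A ⊕ M_B` in the pulled-back frame.** [folklore] -/
theorem map_prodLift_sumElim {ιA ιB : Type} [Fintype ιA] [Fintype ιB] (u : ιA → complexBetti A.X 1)
    (MA : Matrix ιA ιA ℚ) (hMA : ∀ i, complexBetti.map φ.hom.hom.hom 1 (u i) = ∑ j, ((MA j i : ℚ) : ℂ) • u j)
    (w : ιB → complexBetti B.X 1) (MB : Matrix ιB ιB ℚ)
    (hMB : ∀ k, complexBetti.map ψ.hom.hom.hom 1 (w k) = ∑ l, ((MB l k : ℚ) : ℂ) • w l)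
    (s : ιA ⊕ ιB) :
    complexBetti.map (AbelianVariety.prodLift (AbelianVariety.fst A B ≫ φ)
        (AbelianVariety.snd A B ≫ ψ)).hom.hom.hom 1
      (Sum.elim (fun i => complexBetti.map (AbelianVariety.fst A B).hom.hom.hom 1 (u i))
        (fun k => complexBetti.map (AbelianVariety.snd A B).hom.hom.hom 1 (w k)) s) =
    ∑ t, ((Matrix.fromBlocks MA 0 0 MB t s : ℚ) : ℂ) •
      Sum.elim (fun i => complexBetti.map (AbelianVariety.fst A B).hom.hom.hom 1 (u i))
        (fun k => complexBetti.map (AbelianVariety.snd A B).hom.hom.hom 1 (w k)) t := by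
  rcases s with i | k
  · simp only [Sum.elim_inl, Fintype.sum_sum_type, Matrix.fromBlocks_apply₁₁,
      Matrix.fromBlocks_apply₂₁, Matrix.zero_apply, Rat.cast_zero, zero_smul,
      Finset.sum_const_zero, add_zero, Sum.elim_inr]
    rw [map_prodLift_map_fst, hMA, map_sum]
    simp only [map_smul]
  · simp only [Sum.elim_inr, Fintype.sum_sum_type, Matrix.fromBlocks_apply₁₂,
      Matrix.fromBlocks_apply₂₂, Matrix.zero_apply, Rat.cast_zero, zero_smul,
      Finset.sum_const_zero, zero_add, Sum.elim_inl]
    rw [map_prodLift_map_snd, hMB, map_sum]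
    simp only [map_smul]

/-! ### The block Gram matrix and the top power of `pr_A^* h_A + pr_B^* h_B` -/

variable {jA jB : ℕ} (hAdim : A.dim = jA + 1) (hBdim : B.dim = jB + 1) {m : ℕ} (hm : m = jA + jB + 1)

include hAdim hBdim hm

/-- **The block Gram matrix of the product class in the pulled-back frame** (van Geemen's
multiplicativity of the discriminant, Lemma 5.2 (3), cohomological form; file V): with respect to
`ω = pr_A^* ω_A ⌣ pr_B^* ω_B`, the polarization pairing of `pr_A^* h_A + pr_B^* h_B` with exponent
`m = jA + jB + 1` has Gram matrix `C(m, jA)·d_B·G_A ⊕ C(m, jA+1)·d_A·G_B`.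
[cite: vanGeemen1994HodgeAV, Lemma 5.2 (2)–(3)] -/
theorem polarizationPairingOne_sumElim {ιA ιB : Type} (u : ιA → complexBetti A.X 1)
    (w : ιB → complexBetti B.X 1)
    (hA2 : complexBetti A.X 2) (ωA : complexBetti A.X (2 + 2 * jA)) (GA : Matrix ιA ιA ℚ)
    (hGA : ∀ i j, Motives.polarizationPairingOne A.X hA2 jA (u i) (u j) = ((GA i j : ℚ) : ℂ) • ωA)
    (dA : ℚ) (hdA : lefschetzPow hA2 jA 2 hA2 = ((dA : ℚ) : ℂ) • ωA)
    (hB2 : complexBetti B.X 2) (ωB : complexBetti B.X (2 + 2 * jB)) (GB : Matrix ιB ιB ℚ)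
    (hGB : ∀ k l, Motives.polarizationPairingOne B.X hB2 jB (w k) (w l) = ((GB k l : ℚ) : ℂ) • ωB)
    (dB : ℚ) (hdB : lefschetzPow hB2 jB 2 hB2 = ((dB : ℚ) : ℂ) • ωB) (s t : ιA ⊕ ιB) :
    Motives.polarizationPairingOne (A.prod B).X
        (complexBetti.map (AbelianVariety.fst A B).hom.hom.hom 2 hA2 +
          complexBetti.map (AbelianVariety.snd A B).hom.hom.hom 2 hB2) m
        (Sum.elim (fun i => complexBetti.map (AbelianVariety.fst A B).hom.hom.hom 1 (u i))
          (fun k => complexBetti.map (AbelianVariety.snd A B).hom.hom.hom 1 (w k)) s)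
        (Sum.elim (fun i => complexBetti.map (AbelianVariety.fst A B).hom.hom.hom 1 (u i))
          (fun k => complexBetti.map (AbelianVariety.snd A B).hom.hom.hom 1 (w k)) t) =
      ((Matrix.fromBlocks (((m.choose jA : ℚ) * dB) • GA) 0 0 (((m.choose (jA + 1) : ℚ) * dA) • GB) s t
          : ℚ) : ℂ) •
        cupProduct (by omega : (2 + 2 * jA) + (2 + 2 * jB) = 2 + 2 * m)
          (complexBetti.map (AbelianVariety.fst A B).hom.hom.hom (2 + 2 * jA) ωA)
          (complexBetti.map (AbelianVariety.snd A B).hom.hom.hom (2 + 2 * jB) ωB) := by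
  have hX : Motives.IsSmoothProjective (jA + 1) A.X := isSmoothProjective_of_dim_eq' hAdim
  have hY : Motives.IsSmoothProjective (jB + 1) B.X := isSmoothProjective_of_dim_eq' hBdim
  rcases s with i | k <;> rcases t with j | l
  · simp only [Sum.elim_inl, Matrix.fromBlocks_apply₁₁, Matrix.smul_apply, smul_eq_mul]
    rw [polarizationPairingOne_add_map_map _ _ hX hY hA2 hB2 hm, hGA, hdB]
    simp only [map_smul, LinearMap.smul_apply, smul_smul]
    congr 1
    push_cast
    ring
  · simp only [Sum.elim_inl, Sum.elim_inr, Matrix.fromBlocks_apply₁₂, Matrix.zero_apply,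
      Rat.cast_zero, zero_smul]
    exact polarizationPairingOne_add_map_map_mixed _ _ hX hY hA2 hB2 hm (u i) (w l)
  · simp only [Sum.elim_inl, Sum.elim_inr, Matrix.fromBlocks_apply₂₁, Matrix.zero_apply,
      Rat.cast_zero, zero_smul]
    exact polarizationPairingOne_add_map_map_mixed' _ _ hX hY hA2 hB2 hm (u j) (w k)
  · simp only [Sum.elim_inr, Matrix.fromBlocks_apply₂₂, Matrix.smul_apply, smul_eq_mul]
    rw [polarizationPairingOne_add_map_map' _ _ hX hY hA2 hB2 hm, hGB, hdA]
    simp only [map_smul, LinearMap.smul_apply, smul_smul]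
    congr 1
    push_cast
    ring

/-- **The top power of the product class**: `L^m_h h = h^{m+1} = C(m+1, jA+1)·d_A·d_B · ω` for
`h = pr_A^* h_A + pr_B^* h_B`, `m + 1 = dim A + dim B` (`h = pr_A^* h_A ⌣ pr_B^* 1 + pr_A^* 1 ⌣ pr_B^* h_B`;
for each summand the closed form of file V has one surviving term, `C(m, jA)·h_A^{dim A} ⊗ h_B^{dim B}`
and `C(m, jA+1)·h_A^{dim A} ⊗ h_B^{dim B}`; Pascal). [cite: LangeBirkenhake1992, §5.3] -/
theorem lefschetzPow_add_map_self (hA2 : complexBetti A.X 2) (ωA : complexBetti A.X (2 + 2 * jA))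
    (dA : ℚ) (hdA : lefschetzPow hA2 jA 2 hA2 = ((dA : ℚ) : ℂ) • ωA)
    (hB2 : complexBetti B.X 2) (ωB : complexBetti B.X (2 + 2 * jB))
    (dB : ℚ) (hdB : lefschetzPow hB2 jB 2 hB2 = ((dB : ℚ) : ℂ) • ωB) :
    lefschetzPow (complexBetti.map (AbelianVariety.fst A B).hom.hom.hom 2 hA2 +
        complexBetti.map (AbelianVariety.snd A B).hom.hom.hom 2 hB2) m 2
      (complexBetti.map (AbelianVariety.fst A B).hom.hom.hom 2 hA2 +
        complexBetti.map (AbelianVariety.snd A B).hom.hom.hom 2 hB2) =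
      ((((m + 1).choose (jA + 1) : ℚ) * dA * dB : ℚ) : ℂ) •
        cupProduct (by omega : (2 + 2 * jA) + (2 + 2 * jB) = 2 + 2 * m)
          (complexBetti.map (AbelianVariety.fst A B).hom.hom.hom (2 + 2 * jA) ωA)
          (complexBetti.map (AbelianVariety.snd A B).hom.hom.hom (2 + 2 * jB) ωB) := by
  have hX : Motives.IsSmoothProjective (jA + 1) A.X := isSmoothProjective_of_dim_eq' hAdim
  have hY : Motives.IsSmoothProjective (jB + 1) B.X := isSmoothProjective_of_dim_eq' hBdim
  set f := (AbelianVariety.fst A B).hom.hom.hom with hf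
  set g := (AbelianVariety.snd A B).hom.hom.hom with hg
  -- `pr_A^* h_A = pr_A^* h_A ⌣ pr_B^* 1`, `pr_B^* h_B = pr_A^* 1 ⌣ pr_B^* h_B`
  have e1 : complexBetti.map f 2 hA2 = cupProduct (Nat.add_zero 2) (complexBetti.map f 2 hA2)
      (complexBetti.map g 0 (singularCohomology.one ℂ (Motives.ComplexPoints B.X))) := by
    change _ = cupProduct _ _ (singularCohomology.map ℂ ℂ _ 0 (singularCohomology.one ℂ _))
    rw [singularCohomology.map_one, cupProduct_one]
  have e2 : complexBetti.map g 2 hB2 = cupProduct (Nat.zero_add 2)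
      (complexBetti.map f 0 (singularCohomology.one ℂ (Motives.ComplexPoints A.X))) (complexBetti.map g 2 hB2) := by
    change _ = cupProduct _ (singularCohomology.map ℂ ℂ _ 0 (singularCohomology.one ℂ _)) _
    rw [singularCohomology.map_one, one_cupProduct]
  have t1 : lefschetzPow (complexBetti.map f 2 hA2 + complexBetti.map g 2 hB2) m 2 (complexBetti.map f 2 hA2) =
      (((m.choose jA : ℚ) * dA * dB : ℚ) : ℂ) •
        cupProduct (by omega : (2 + 2 * jA) + (2 + 2 * jB) = 2 + 2 * m)
          (complexBetti.map f (2 + 2 * jA) ωA) (complexBetti.map g (2 + 2 * jB) ωB) := by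
    nth_rewrite 2 [e1]
    rw [lefschetzPow_add_map_cupProduct_eq_single f g hX hY m (Nat.add_zero 2) hA2 hB2 _ _ jA (jB + 1)
        (by omega) (by omega) (by omega),
      lefschetzPow_succ_one_eq_degCast, map_degCast, cupProduct_degCast_right, hdA, hdB]
    simp only [map_smul, LinearMap.smul_apply, smul_smul]
    congr 1
    push_cast
    ring
  have t2 : lefschetzPow (complexBetti.map f 2 hA2 + complexBetti.map g 2 hB2) m 2 (complexBetti.map g 2 hB2) =
      (((m.choose (jA + 1) : ℚ) * dA * dB : ℚ) : ℂ) •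
        cupProduct (by omega : (2 + 2 * jA) + (2 + 2 * jB) = 2 + 2 * m)
          (complexBetti.map f (2 + 2 * jA) ωA) (complexBetti.map g (2 + 2 * jB) ωB) := by
    nth_rewrite 2 [e2]
    rw [lefschetzPow_add_map_cupProduct_eq_single f g hX hY m (Nat.zero_add 2) hA2 hB2 _ _ (jA + 1) jB
        (by omega) (by omega) (by omega),
      lefschetzPow_succ_one_eq_degCast, map_degCast, cupProduct_degCast_left, hdA, hdB]
    simp only [map_smul, LinearMap.smul_apply, smul_smul]
    congr 1
    push_cast
    ring
  rw [map_add, t1, t2, ← add_smul]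
  congr 1
  rw [hm, Nat.choose_succ_succ' (jA + jB + 1) jA]
  push_cast
  ring

end Summit.HodgeConjecture.HodgeConjecture.Theorems

end
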